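import Mathlib
import Summits.KontsevichZagierPeriods.Zeta5Search.BrickTwistedConstantTerm
import Summits.KontsevichZagierPeriods.Zeta5Search.BrickPropositionHDepth

/-!
# BrickDenominatorsOddC — Krattenthaler–Rivoal's THÉORÈME 1 (ii) for the symmetric very-well-poised bricks `r = 1`, `A` even,
and ODD `C`, AT EVERY ODD PRIME: `v_p(2·d_n^{A+C−1}·p_{0,C,n}((−1)^A)) ≥ 0` (cell `pub-zeta5`, seat ct-1 g45)

HONEST FRAMING: systematic search; no irrationality claim unless certified.  INTEGRALITY (at odd primes) of the rational
constant terms `p_{0,C,n}(1)` of the `C`-fold differentiated very-well-poised brick linear forms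
`Σ_{k≥1}(1/C!)R_n^{(C)}(k) = p_{0,C,n}(1) + (−1)^C Σ_l binom(C+l−1,l−1)p_{l,n}(1)ζ(C+l)`,
`R_n(t) = n!^{A−2B}(t + n/2)(t−n)_n^B(t+n+1)_n^B/(t)_{n+1}^A` (Krattenthaler–Rivoal, *Hypergéométrie et fonction zêta de Riemann*,
Mem. AMS **186** (2007) no. 875, §2.4 (eq:p0C); §3 Théorème 1 (ii): «`2d_n^{A+C−1}p_{0,C,n}((−1)^A)` sont des nombres entiers»,
arXiv:math/0311114 p. 8) — a theorem in print since 2007, reproduced here for `r = 1`, `A` even, `C` ODD, at the ODD primes, by a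
DIFFERENT ROUTE: ct-1 g45's identity `2·p_{0,C,n}(1) = −Σ_m [T^{A+C}]F_m` (`BrickTwistedConstantTerm`) and PROPOSITION H^∞ at
depth `A + C` (`BrickPropositionHDepth`).  WHAT THIS IS NOT: nothing at the prime `2` (where the printed factor `2` lives — the
depth versions of ct-1 g42–g44's 2-adic chain are the successor item); nothing for EVEN `C ≥ 2` (the two triangles cancel; the
`C`-twisted harmonic cell would be needed); `C = 0` is zi-eng's `BrickDenominators.theoreme1_odd_prime` + ct-1 g44's
`BrickDenominatorsTwo.theoreme1_r_one`; the named fact `KrattenthalerRivoal2007.theoreme1` (all `A ≥ 2`, `C ≥ 0`, `r ≥ 0`) is NOT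
discharged; nothing about the arithmetic nature of `ζ(5)`/`ζ(3)`; no `γ` / `μ` / denominator-law / record statement; records in
print UNMOVED.  Theorems only (0 `def`).

* `pZero_one_eq_twisted` — `p_{0,C,n}(1) = −(−1)^C Σ_{K≤n}Σ_{s∈[1,A]} binom(s+C−1,C)·c_{K,s}(n)·H_K^{(s+C)}` for all partial-fraction
  data `c` of `R_{n,A,B,1}` (zi-eng's `data_eq_cell`; `C = 0`: `pZero_one_eq_xZero`);
* `two_mul_pZero_one_eq` — **`2·p_{0,C,n}(1) = −Σ_{m≤n} [T^{A+C}]F_m`** (`C` odd, `A` even);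
* **`theoreme1_ii_odd_prime`** — `v_p(2·d_n^{A+C−1}·p_{0,C,n}((−1)^A)) ≤ 1` for every odd prime `p`, `A` even, `1 ≤ B`, `2B ≤ A`,
  `C` odd, every `n`, all data `c`; `padicValuation_pZero_one_le` — the level form `ord_p p_{0,C,n}(1) ≥ −⌊log_p n⌋(A+C−1)`;
* `theoreme1_ii_odd_den_two_pow` — across the odd primes: the denominator of `d_n^{A+C−1}·p_{0,C,n}((−1)^A)` is a power of `2`.
DATA (seat desk `alg/twistcheck.py` of ct-1 g44 = `twistC.py`, and `alg/laurent.py`, exact, not used by the kernel): `2d_n^{A+C−1}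
p_{0,C,n}(1) ∈ ℤ` on `(4,1),(6,1),(6,2),(8,3)`, `C ≤ 3`, `n ≤ 16`, odd-prime margins tight (`p = 3, 5, 7`).
-/

namespace Summit.KontsevichZagierPeriods.Zeta5Search.BrickDenominatorsOddC

open Finset Nat WithZero
open Summit.KontsevichZagierPeriods.Zeta5Search.BrickLaurent (laurent cell)
open Summit.KontsevichZagierPeriods.Zeta5Search.BrickHarmonicBlocks (hsum)
open Summit.KontsevichZagierPeriods.Zeta5Search.BrickDenominators (data_eq_cell den_eq_two_pow_of_padicValuation_le)
open Summit.KontsevichZagierPeriods.Zeta5Search.BrickTwistedConstantTerm (two_mul_twisted_eq_neg_sum_laurent)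
open Summit.KontsevichZagierPeriods.Zeta5Search.BrickPropositionHDepth (padicValuation_sum_laurent_le
  padicValuation_lcmUpto_pow_mul_sum_laurent_le)
open Literature.NumberTheory.Irrationality.KrattenthalerRivoal2007 (IsPartialFractionData pZero)
open Literature.NumberTheory.LFunctions (padicValuation_natCast_eq_one)

noncomputable section

/-! ## Krattenthaler–Rivoal's twisted constant term in brick vocabulary -/

/-- **`p_{0,C,n}(1) = −(−1)^C·Σ_{K≤n}Σ_{s∈[1,A]} binom(s+C−1, C)·c_{K,s}(n)·H_K^{(s+C)}`** for every `C` and all partial-fraction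
data `c` of `R_{n,A,B,1}` (`2B ≤ A`, `1 < A`): KR's (eq:p0C) at `z = 1`, the data identified with the cells by uniqueness
(`BrickDenominators.data_eq_cell`), `binom(C+e−1, e−1) = binom(e+C−1, C)`. -/
theorem pZero_one_eq_twisted {A B : ℕ} (hAB : 2 * B ≤ A) (hA1 : 1 < A) {n : ℕ} {c : ℕ → ℕ → ℚ}
    (hc : IsPartialFractionData n A B 1 c) (C : ℕ) :
    pZero n A C c 1 = -(-1) ^ C * ∑ K ∈ range (n + 1), ∑ s ∈ Icc 1 A,
      (Nat.choose (s + C - 1) C : ℚ) * cell A B 1 n K s * hsum (s + C) K := by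
  rw [pZero, neg_mul, Finset.mul_sum]
  refine congrArg Neg.neg (Finset.sum_congr rfl fun K hK => ?_)
  have hKn : K ≤ n := by have := mem_range.1 hK; omega
  rw [Finset.mul_sum]
  refine Finset.sum_congr rfl fun e he => ?_
  have he' := mem_Icc.1 he
  have hch : (Nat.choose (C + e - 1) (e - 1) : ℚ) = Nat.choose (e + C - 1) C := by
    rw [show C + e - 1 = (e - 1) + C by omega, show e + C - 1 = (e - 1) + C by omega, Nat.choose_symm_add]
  rw [hch, data_eq_cell hAB hA1 hc (by omega) hKn, Nat.sub_add_cancel he'.1, hsum]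
  rw [Finset.sum_congr rfl fun i _ => by rw [one_pow]]
  ring

/-- **`2·p_{0,C,n}(1) = −Σ_{m≤n} [T^{A+C}]F_m`** for ODD `C` (`A` even, `2B ≤ A`, `1 < A`): Krattenthaler–Rivoal's constant term,
doubled, is minus the sum of the regular Taylor coefficients of order `C` of `R_n` at its poles (`BrickTwistedConstantTerm`). -/
theorem two_mul_pZero_one_eq {A B : ℕ} (hA : Even A) (hAB : 2 * B ≤ A) (hA1 : 1 < A) {C : ℕ} (hC : Odd C) {n : ℕ}
    {c : ℕ → ℕ → ℚ} (hc : IsPartialFractionData n A B 1 c) :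
    2 * pZero n A C c 1 = -∑ m ∈ range (n + 1), laurent A B 1 n m (A + C) := by
  rw [pZero_one_eq_twisted hAB hA1 hc C, hC.neg_one_pow, neg_neg, one_mul]
  exact two_mul_twisted_eq_neg_sum_laurent hA hAB hA1 hC n

/-! ## Théorème 1 (ii) for odd `C` at every odd prime -/

section odd

variable {p : ℕ} [Fact p.Prime] (hp2 : p ≠ 2) {A B : ℕ} (hA : Even A) (hB : 1 ≤ B) (hAB : 2 * B ≤ A) {C : ℕ} (hC : Odd C)
include hp2 hA hB hAB hC

/-- **Level form**: `ord_p p_{0,C,n}(1) ≥ −⌊log_p n⌋·(A + C − 1)` — indeed `v_p(2·p_{0,C,n}(1)) ≤ exp(⌊log_p n⌋·(A+C−1))` — for every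
odd prime `p`, `A` even, `1 ≤ B`, `2B ≤ A`, `C` odd, every `n` and all data `c` of `R_{n,A,B,1}`. -/
theorem padicValuation_pZero_one_le {n : ℕ} {c : ℕ → ℕ → ℚ} (hc : IsPartialFractionData n A B 1 c) :
    Rat.padicValuation p (2 * pZero n A C c 1) ≤ exp ((Nat.log p n : ℤ) * (((A + C : ℕ) : ℤ) - 1)) := by
  rw [two_mul_pZero_one_eq hA hAB (by omega) hC hc, Valuation.map_neg]
  exact padicValuation_sum_laurent_le hp2 hA hB hAB n (A + C)

/-- **KRATTENTHALER–RIVOAL 2007, THÉORÈME 1 (ii), for `r = 1`, `A` even, `1 ≤ B`, `2B ≤ A`, ODD `C`, AT AN ODD PRIME `p`**: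
`v_p(2·d_n^{A+C−1}·p_{0,C,n}((−1)^A)) ≤ 1` for every `n` and all partial-fraction data `c` of `R_{n,A,B,1}` (`d_n = lcm(1,…,n)`).
PROOF ROUTE ≠ PRINT: `2·p_{0,C,n}(1) = −Σ_m[T^{A+C}]F_m` and PROPOSITION H^∞ at depth `A + C` with the constant weight.
[Krattenthaler–Rivoal, Mem. AMS 186 (2007) no. 875, §3 Théorème 1 (ii); arXiv:math/0311114 p. 8] -/
theorem theoreme1_ii_odd_prime {n : ℕ} {c : ℕ → ℕ → ℚ} (hc : IsPartialFractionData n A B 1 c) :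
    Rat.padicValuation p (2 * ((Nat.lcmUpto n : ℕ) : ℚ) ^ (A + C - 1) * pZero n A C c ((-1) ^ A)) ≤ 1 := by
  rw [hA.neg_one_pow, mul_assoc, mul_left_comm, two_mul_pZero_one_eq hA hAB (by omega) hC hc, mul_neg, Valuation.map_neg]
  exact padicValuation_lcmUpto_pow_mul_sum_laurent_le hp2 hA hB hAB n (d := A + C) (by omega)

end odd

/-- **Across the odd primes** (`A` even, `1 ≤ B`, `2B ≤ A`, `C` odd): the denominator of `d_n^{A+C−1}·p_{0,C,n}((−1)^A)` is a power of
`2` — the print has `2·d_n^{A+C−1}·p_{0,C,n}((−1)^A) ∈ ℤ`; the prime `2` is not treated in this file. -/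
theorem theoreme1_ii_odd_den_two_pow {A B : ℕ} (hA : Even A) (hB : 1 ≤ B) (hAB : 2 * B ≤ A) {C : ℕ} (hC : Odd C) {n : ℕ}
    {c : ℕ → ℕ → ℚ} (hc : IsPartialFractionData n A B 1 c) :
    ∃ k : ℕ, (((Nat.lcmUpto n : ℕ) : ℚ) ^ (A + C - 1) * pZero n A C c ((-1) ^ A)).den = 2 ^ k := by
  refine den_eq_two_pow_of_padicValuation_le fun p hp hp2 => ?_
  have h := @theoreme1_ii_odd_prime p ⟨hp⟩ hp2 A B hA hB hAB C hC n c hc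
  have h2 : @Rat.padicValuation p ⟨hp⟩ (2 : ℚ) = 1 := by
    rw [show (2 : ℚ) = ((2 : ℕ) : ℚ) by norm_num]
    exact @padicValuation_natCast_eq_one p ⟨hp⟩ 2 fun h => hp2 ((Nat.prime_dvd_prime_iff_eq hp Nat.prime_two).1 h)
  rwa [mul_assoc, map_mul, h2, one_mul] at h

end

end Summit.KontsevichZagierPeriods.Zeta5Search.BrickDenominatorsOddC
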